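import Mathlib
import Literature.NumberTheory.Irrationality.DirichletLValues.ChowlaMilnorOddEvenSplitProofs
import Literature.NumberTheory.Transcendental.BoxIntegralCatalanLevelFour
import HarnessLib

/-!
# The Chowlas' number `α = G / L(2, χ₋₃)` and the Chowla–Milnor conjecture at `q = 12`, `k = 2`
# (Gun–Murty–Rath 2011, Proposition 5)

Topic `Literature/NumberTheory/Irrationality/DirichletLValues`. Proofs-only leaf (theorems only, no definition, no
named fact, no `sorry`; cell pub-zeta5, P1 g54), sequel of `ChowlaMilnorOddEvenSplitProofs.lean` (Lai–Li's equivalent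
form of the Chowla–Milnor conjecture, `finrank_span_eq_totient_iff`), using the tree's Catalan constant
(`Transcendental.catalanConstant = Σ (−1)^n/(2n+1)²`, `PeriodsWave0.lean`; `BoxIntegralCatalanLevelFour.lean`:
`Σ_k 1/(4k+1)² − Σ_k 1/(4k+3)² = G`).

## Source (read on the page)

S. Gun, M. R. Murty, P. Rath, *On a conjecture of Chowla and Milnor*, Canad. J. Math. **63** (2011) 1328–1344
[GunRammurtyRath2011], §4 (pp. 1341–1342): «In their paper, P. and S. Chowla mention the following number
`α := (1^{−2} − 3^{−2} + 5^{−2} − 7^{−2} + − ⋯)/(1^{−2} − 2^{−2} + 4^{−2} − 5^{−2} + − ⋯)`. Questions about its irrationality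
have been raised by A. Borel, Lichtenstein, Milnor and Thurston. We note the following. **Proposition 5** The
Chowla–Milnor conjecture for `q = 12` and `k = 2` implies that `α` is irrational. *Proof.* We note that
`α = L(2, χ₄)/L(2, χ₃)`, where `χ₄` and `χ₃` are odd quadratic characters modulo `4` and `3` respectively. These
characters lift to two distinct imprimitive characters modulo `12`. If `α` is a rational number, then since
`L(2, χ₄) − αL(2, χ₃) = 0`, this will imply that the dimension of `V₂(12)` is at most `3`.» Also p. 1329:
«Substituting `(p^k − 1)ζ(k) = Σ_{a=1}^{p−1} ζ(k, a/p)` in the expression (1)» (the distribution relation), whose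
general form for the Hurwitz zeta function is the Kubert identity of Milnor [Milnor1983].

## What is proved (`ζ(k,x) = hurwitzValue k x`, `ζ⁻(k,x) = hurwitzOdd k x = ζ(k,x) − (−1)^k ζ(k,1−x)`)

* `sum_range_hurwitzValue_progression` — the multiplication (distribution) formula at rational points:
  `Σ_{j<d} ζ(s, (u + jv)/(vd)) = d^s ζ(s, u/v)` (`u, v, d ≥ 1`, `s ≥ 2`);
* `hurwitzValue_quarter_sub_eq_catalan` — `ζ(2, 1/4) − ζ(2, 3/4) = 16·G` (numerator: `16·Σ(−1)^n/(2n+1)²`);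
* `tsum_three_eq_hurwitzValue_third_sub` — `Σ_n [(3n+1)^{−2} − (3n+2)^{−2}] = (ζ(2,1/3) − ζ(2,2/3))/9` (denominator,
  the printed series grouped in pairs — it converges absolutely);
* **`hurwitzOdd_twelve_add`**, **`hurwitzOdd_twelve_sub`** — the lifts to the modulus `12`:
  `ζ⁻(2,1/12) + ζ⁻(2,5/12) = 160·G` (`= 12²·L(2, χ₄ mod 12)`), `ζ⁻(2,1/12) − ζ⁻(2,5/12) = 20(ζ(2,1/3) − ζ(2,2/3))`
  (`= 12²·L(2, χ₃ mod 12)`);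
* **`irrational_chowla_alpha_of_finrank_eq`** — PROPOSITION 5: if `dim_ℚ V₂(12) = φ(12)` («the Chowla–Milnor conjecture
  for `q = 12` and `k = 2`», `V_k(q)` written out as in the companion files) then
  `α = G / Σ_n [(3n+1)^{−2} − (3n+2)^{−2}]` is irrational. Route: a rational `α` is a non-trivial rational relation between
  the two generators `ζ⁻(2,1/12)`, `ζ⁻(2,5/12)` of the typed odd space `V₂⁻(12)`, so `dim V₂⁻(12) ≤ 1 < 2 = φ(12)/2`,
  contradicting Lai–Li's equivalent form (`finrank_span_eq_totient_iff`) — sharper than the printed «at most `3`», same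
  conclusion.

HONEST FRAMING (cells pub-zeta5 / zeta5-irr / the Catalan family): a printed CM-conditional implication with the
conjecture INLINE as hypothesis; the irrationality of `α` (and of `G`) stays OPEN; net named-fact debt 0; nothing
here concerns `ζ(5)`.
-/

noncomputable section

open Finset

open scoped Nat

namespace Literature.NumberTheory.Irrationality.DirichletLValues

open Literature.NumberTheory.Transcendental

/-! ### The multiplication formula at rational points -/

/-- **Multiplication (distribution) formula for the Hurwitz zeta values at rational points**: for `u, v, d ≥ 1`,
`s ≥ 2`, `Σ_{j<d} ζ(s, (u + jv)/(vd)) = d^s · ζ(s, u/v)` — the progression `u + vℕ` split along the residues of the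
index mod `d` (the case `u = v = 1` is the display «`(p^k − 1)ζ(k) = Σ_{a=1}^{p−1} ζ(k, a/p)`» of p. 1329; general form:
Milnor's Kubert identity). [cite: GunRammurtyRath2011, p. 1329 (display before Milnor's conjecture)]
[cite: Milnor1983, §2 (Kubert identities for ζ(s, x))] -/
theorem sum_range_hurwitzValue_progression {u v d s : ℕ} (hu : 1 ≤ u) (hv : 1 ≤ v) (hd : 1 ≤ d) (hs : 2 ≤ s) :
    ∑ j ∈ range d, hurwitzValue s (((u + j * v : ℕ) : ℝ) / ((v * d : ℕ) : ℝ)) =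
      (d : ℝ) ^ s * hurwitzValue s ((u : ℝ) / v) := by
  obtain ⟨n, rfl⟩ : ∃ n, d = n + 1 := ⟨d - 1, by omega⟩
  set f : ℕ → ℝ := fun m => 1 / (((u + m * v : ℕ) : ℝ)) ^ s with hf_def
  have hf : HasSum f (1 / (v : ℝ) ^ s * hurwitzValue s ((u : ℝ) / v)) := hasSum_progression_hurwitzValue hu hv hs
  have hsplit : ∑' m, f m = ∑ j : ZMod (n + 1), ∑' m, f (j.val + (n + 1) * m) :=
    Nat.sumByResidueClasses hf.summable (n + 1)
  have hfin : (∑ j : ZMod (n + 1), ∑' m, f (j.val + (n + 1) * m)) =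
      ∑ i ∈ range (n + 1), ∑' m, f (i + (n + 1) * m) :=
    Fin.sum_univ_eq_sum_range (fun i => ∑' m, f (i + (n + 1) * m)) (n + 1)
  have hclass : ∀ i ∈ range (n + 1), ∑' m, f (i + (n + 1) * m) =
      1 / (((v * (n + 1) : ℕ) : ℝ)) ^ s * hurwitzValue s (((u + i * v : ℕ) : ℝ) / ((v * (n + 1) : ℕ) : ℝ)) := by
    intro i _
    have h := hasSum_progression_hurwitzValue (u := u + i * v) (v := v * (n + 1)) (s := s) (by omega)
      (Nat.le_mul_of_pos_right _ (by omega) |>.trans' hv) hs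
    rw [← h.tsum_eq]
    refine tsum_congr fun m => ?_
    simp only [hf_def]
    congr 3
    ring
  rw [hf.tsum_eq, hfin, sum_congr rfl hclass, ← mul_sum] at hsplit
  have hv0 : (v : ℝ) ≠ 0 := by exact_mod_cast (show v ≠ 0 by omega)
  have hn0 : ((n + 1 : ℕ) : ℝ) ≠ 0 := by exact_mod_cast (show n + 1 ≠ 0 by omega)
  have hvn : (((v * (n + 1) : ℕ) : ℝ)) ^ s = (v : ℝ) ^ s * ((n + 1 : ℕ) : ℝ) ^ s := by
    rw [Nat.cast_mul, mul_pow]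
  rw [hvn] at hsplit
  have e := congrArg (fun x => (v : ℝ) ^ s * ((n + 1 : ℕ) : ℝ) ^ s * x) hsplit
  rw [show (v : ℝ) ^ s * ((n + 1 : ℕ) : ℝ) ^ s * (1 / (v : ℝ) ^ s * hurwitzValue s ((u : ℝ) / v)) =
      ((n + 1 : ℕ) : ℝ) ^ s * hurwitzValue s ((u : ℝ) / v) by field_simp,
    show (v : ℝ) ^ s * ((n + 1 : ℕ) : ℝ) ^ s * (1 / ((v : ℝ) ^ s * ((n + 1 : ℕ) : ℝ) ^ s) *
      ∑ i ∈ range (n + 1), hurwitzValue s (((u + i * v : ℕ) : ℝ) / ((v * (n + 1) : ℕ) : ℝ))) =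
      ∑ i ∈ range (n + 1), hurwitzValue s (((u + i * v : ℕ) : ℝ) / ((v * (n + 1) : ℕ) : ℝ)) by field_simp] at e
  exact e.symm

/-! ### The numerator: Catalan's constant -/

/-- **`ζ(2, 1/4) − ζ(2, 3/4) = 16·G`**, `G = Σ_n (−1)^n/(2n+1)²` the tree's `catalanConstant`
(`1^{−2} − 3^{−2} + 5^{−2} − ⋯ = G`, the numerator of `α`). [cite: GunRammurtyRath2011, §4 p. 1341 (α and L(2, χ₄))] -/
theorem hurwitzValue_quarter_sub_eq_catalan :
    hurwitzValue 2 (1 / 4) - hurwitzValue 2 (3 / 4) = 16 * catalanConstant := by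
  have p1 := (hasSum_progression_hurwitzValue (u := 1) (v := 4) (s := 2) le_rfl (by norm_num) le_rfl).tsum_eq
  have p3 := (hasSum_progression_hurwitzValue (u := 3) (v := 4) (s := 2) (by norm_num) (by norm_num) le_rfl).tsum_eq
  have e1 : ∑' m : ℕ, 1 / (((1 + m * 4 : ℕ) : ℝ)) ^ 2 = ∑' k : ℕ, 1 / ((4 : ℝ) * k + 1) ^ 2 :=
    tsum_congr fun m => by push_cast; ring_nf
  have e3 : ∑' m : ℕ, 1 / (((3 + m * 4 : ℕ) : ℝ)) ^ 2 = ∑' k : ℕ, 1 / ((4 : ℝ) * k + 3) ^ 2 :=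
    tsum_congr fun m => by push_cast; ring_nf
  have hG := BoxIntegral.tsum_one_div_four_mul_add_one_sq_sub
  rw [← e1, ← e3, p1, p3] at hG
  norm_num at hG ⊢
  linarith

/-! ### The denominator: `L(2, χ₋₃)` grouped in pairs -/

/-- **`Σ_n [(3n+1)^{−2} − (3n+2)^{−2}] = (ζ(2,1/3) − ζ(2,2/3))/9`** — the denominator
`1^{−2} − 2^{−2} + 4^{−2} − 5^{−2} + − ⋯` of `α` (grouped in consecutive pairs; both halves converge absolutely).
[cite: GunRammurtyRath2011, §4 p. 1341 (α and L(2, χ₃))] -/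
theorem tsum_three_eq_hurwitzValue_third_sub :
    ∑' n : ℕ, (1 / ((3 : ℝ) * n + 1) ^ 2 - 1 / ((3 : ℝ) * n + 2) ^ 2) =
      (hurwitzValue 2 (1 / 3) - hurwitzValue 2 (2 / 3)) / 9 := by
  have h1 := hasSum_progression_hurwitzValue (u := 1) (v := 3) (s := 2) le_rfl (by norm_num) le_rfl
  have h2 := hasSum_progression_hurwitzValue (u := 2) (v := 3) (s := 2) (by norm_num) (by norm_num) le_rfl
  push_cast at h1 h2
  have h1' : HasSum (fun n : ℕ => 1 / ((3 : ℝ) * n + 1) ^ 2) (1 / (3 : ℝ) ^ 2 * hurwitzValue 2 (1 / 3)) :=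
    h1.congr_fun fun n => by ring
  have h2' : HasSum (fun n : ℕ => 1 / ((3 : ℝ) * n + 2) ^ 2) (1 / (3 : ℝ) ^ 2 * hurwitzValue 2 (2 / 3)) :=
    h2.congr_fun fun n => by ring
  rw [(h1'.sub h2').tsum_eq]
  ring

/-! ### The lifts to the modulus `12` -/

/-- `ζ(2,1/12) + ζ(2,5/12) + ζ(2,3/4) = 9ζ(2,1/4)` and `ζ(2,1/4) + ζ(2,7/12) + ζ(2,11/12) = 9ζ(2,3/4)` (multiplication
formula, `d = 3`). [folklore] -/
private theorem twelve_quarter :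
    hurwitzValue 2 (1 / 12) + hurwitzValue 2 (5 / 12) + hurwitzValue 2 (3 / 4) = 9 * hurwitzValue 2 (1 / 4) ∧
      hurwitzValue 2 (1 / 4) + hurwitzValue 2 (7 / 12) + hurwitzValue 2 (11 / 12) = 9 * hurwitzValue 2 (3 / 4) := by
  have ha := sum_range_hurwitzValue_progression (u := 1) (v := 4) (d := 3) (s := 2) le_rfl (by norm_num)
    (by norm_num) le_rfl
  have hb := sum_range_hurwitzValue_progression (u := 3) (v := 4) (d := 3) (s := 2) (by norm_num) (by norm_num)
    (by norm_num) le_rfl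
  simp only [sum_range_succ, sum_range_zero, zero_add] at ha hb
  norm_num at ha hb
  exact ⟨by linarith, by linarith⟩

/-- `ζ(2,1/12) + ζ(2,1/3) + ζ(2,7/12) + ζ(2,5/6) = 16ζ(2,1/3)`, `ζ(2,1/6) + ζ(2,5/12) + ζ(2,2/3) + ζ(2,11/12) = 16ζ(2,2/3)`,
`ζ(2,1/6) + ζ(2,2/3) = 4ζ(2,1/3)`, `ζ(2,1/3) + ζ(2,5/6) = 4ζ(2,2/3)` (multiplication formula, `d = 4`, `d = 2`).
[folklore] -/
private theorem twelve_third :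
    hurwitzValue 2 (1 / 12) + hurwitzValue 2 (1 / 3) + hurwitzValue 2 (7 / 12) + hurwitzValue 2 (5 / 6) =
        16 * hurwitzValue 2 (1 / 3) ∧
      hurwitzValue 2 (1 / 6) + hurwitzValue 2 (5 / 12) + hurwitzValue 2 (2 / 3) + hurwitzValue 2 (11 / 12) =
        16 * hurwitzValue 2 (2 / 3) ∧
      hurwitzValue 2 (1 / 6) + hurwitzValue 2 (2 / 3) = 4 * hurwitzValue 2 (1 / 3) ∧
      hurwitzValue 2 (1 / 3) + hurwitzValue 2 (5 / 6) = 4 * hurwitzValue 2 (2 / 3) := by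
  have ha := sum_range_hurwitzValue_progression (u := 1) (v := 3) (d := 4) (s := 2) le_rfl (by norm_num)
    (by norm_num) le_rfl
  have hb := sum_range_hurwitzValue_progression (u := 2) (v := 3) (d := 4) (s := 2) (by norm_num) (by norm_num)
    (by norm_num) le_rfl
  have hc := sum_range_hurwitzValue_progression (u := 1) (v := 3) (d := 2) (s := 2) le_rfl (by norm_num)
    (by norm_num) le_rfl
  have hd := sum_range_hurwitzValue_progression (u := 2) (v := 3) (d := 2) (s := 2) (by norm_num) (by norm_num)
    (by norm_num) le_rfl
  simp only [sum_range_succ, sum_range_zero, zero_add] at ha hb hc hd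
  norm_num at ha hb hc hd
  exact ⟨by linarith, by linarith, by linarith, by linarith⟩

/-- **`ζ⁻(2, 1/12) + ζ⁻(2, 5/12) = 160·G`** — the lift of `χ₄` to the modulus `12`:
`Σ_{(a,12)=1} χ₄(a) ζ(2, a/12) = 144·L(2, χ₄ mod 12) = 144·(1 + 1/9)·G`. [cite: GunRammurtyRath2011, proof of Proposition 5 (p. 1342)] -/
theorem hurwitzOdd_twelve_add :
    hurwitzOdd 2 (1 / 12) + hurwitzOdd 2 (5 / 12) = 160 * catalanConstant := by
  obtain ⟨ha, hb⟩ := twelve_quarter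
  have hG := hurwitzValue_quarter_sub_eq_catalan
  simp only [hurwitzOdd]
  norm_num
  linarith

/-- **`ζ⁻(2, 1/12) − ζ⁻(2, 5/12) = 20·(ζ(2,1/3) − ζ(2,2/3))`** (`= 180·Σ_n [(3n+1)^{−2} − (3n+2)^{−2}]`) — the lift of
`χ₃` to the modulus `12`: `Σ_{(a,12)=1} χ₃(a) ζ(2, a/12) = 144·L(2, χ₃ mod 12) = 144·(1 + 1/4)·L(2, χ₃)`.
[cite: GunRammurtyRath2011, proof of Proposition 5 (p. 1342)] -/
theorem hurwitzOdd_twelve_sub :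
    hurwitzOdd 2 (1 / 12) - hurwitzOdd 2 (5 / 12) = 20 * (hurwitzValue 2 (1 / 3) - hurwitzValue 2 (2 / 3)) := by
  obtain ⟨ha, hb, hc, hd⟩ := twelve_third
  simp only [hurwitzOdd]
  norm_num
  linarith

/-! ### Proposition 5 -/

/-- The generators of `V₂⁻(12)` are `ζ⁻(2,1/12)` and `ζ⁻(2,5/12)`. [folklore] -/
private theorem oddChowlaMilnorSpace_two_twelve :
    oddChowlaMilnorSpace 2 12 = Submodule.span ℚ (Set.range ![hurwitzOdd 2 (1 / 12), hurwitzOdd 2 (5 / 12)]) := by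
  unfold oddChowlaMilnorSpace
  congr 1
  ext y
  simp only [Set.mem_setOf_eq, Set.mem_range]
  constructor
  · rintro ⟨a, ha1, h2a, hcop, rfl⟩
    have ha6 : a < 6 := by omega
    interval_cases a
    · exact ⟨0, by norm_num⟩
    · exact absurd hcop (by norm_num)
    · exact absurd hcop (by norm_num)
    · exact absurd hcop (by norm_num)
    · exact ⟨1, by norm_num⟩
  · rintro ⟨i, rfl⟩
    fin_cases i
    · exact ⟨1, le_rfl, by norm_num, by norm_num, by norm_num⟩
    · exact ⟨5, by norm_num, by norm_num, by norm_num, by norm_num⟩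

/-- **Gun–Murty–Rath 2011, Proposition 5** «The Chowla–Milnor conjecture for `q = 12` and `k = 2` implies that `α` is
irrational», `α = (1^{−2} − 3^{−2} + 5^{−2} − ⋯)/(1^{−2} − 2^{−2} + 4^{−2} − 5^{−2} + − ⋯) = G / Σ_n [(3n+1)^{−2} − (3n+2)^{−2}]`
(the number of P. and S. Chowla; «questions about its irrationality have been raised by A. Borel, Lichtenstein, Milnor and
Thurston»). Typed with the conjecture INLINE as `dim_ℚ V₂(12) = φ(12)`. Proof: by the lifts to the modulus `12`,
`α = (9/8)·(ζ⁻(2,1/12) + ζ⁻(2,5/12))/(ζ⁻(2,1/12) − ζ⁻(2,5/12))`; a rational `α` is a non-trivial rational relation between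
the two generators of `V₂⁻(12)`, so `dim_ℚ V₂⁻(12) ≤ 1 < φ(12)/2`, contradicting Lai–Li's equivalent form of the
conjecture (`finrank_span_eq_totient_iff`). [cite: GunRammurtyRath2011, Proposition 5 and its proof (pp. 1341–1342)] -/
theorem irrational_chowla_alpha_of_finrank_eq
    (hCM : Module.finrank ℚ ↥(Submodule.span ℚ {y : ℝ | ∃ a : ℕ, 1 ≤ a ∧ a < 12 ∧ Nat.Coprime a 12 ∧
        y = hurwitzValue 2 ((a : ℝ) / (12 : ℕ))}) = Nat.totient 12) :
    Irrational (catalanConstant / ∑' n : ℕ, (1 / ((3 : ℝ) * n + 1) ^ 2 - 1 / ((3 : ℝ) * n + 2) ^ 2)) := by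
  intro hrat
  obtain ⟨r, hr⟩ := Set.mem_range.1 hrat
  have hD₃pos : 0 < hurwitzValue 2 (1 / 3) - hurwitzValue 2 (2 / 3) := by
    rw [sub_pos]
    exact hurwitzValue_lt_of_lt (by norm_num) (by norm_num) le_rfl
  have hadd := hurwitzOdd_twelve_add
  have hsub := hurwitzOdd_twelve_sub
  rw [tsum_three_eq_hurwitzValue_third_sub] at hr
  -- `G = r·D₃/9`, hence `9(h₁ + h₅) = 8r(h₁ − h₅)`: a rational relation between the two generators
  have hG : catalanConstant = (r : ℝ) * ((hurwitzValue 2 (1 / 3) - hurwitzValue 2 (2 / 3)) / 9) := by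
    rw [eq_div_iff (by positivity)] at hr
    rw [← hr]
  have hrel : ((9 - 8 * r : ℚ) : ℝ) * hurwitzOdd 2 (1 / 12) + ((9 + 8 * r : ℚ) : ℝ) * hurwitzOdd 2 (5 / 12) = 0 := by
    push_cast
    linear_combination (9 : ℝ) * hadd - 8 * (r : ℝ) * hsub + (1440 : ℝ) * hG
  -- hence the two generators of `V₂⁻(12)` are dependent
  have hdep : ¬ LinearIndependent ℚ ![hurwitzOdd 2 (1 / 12), hurwitzOdd 2 (5 / 12)] := by
    intro hli
    rw [Fintype.linearIndependent_iff] at hli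
    have h0 := hli ![9 - 8 * r, 9 + 8 * r] (by
      simp only [Fin.sum_univ_two, Matrix.cons_val_zero, Matrix.cons_val_one, Rat.smul_def]
      exact_mod_cast hrel)
    have e0 := h0 0
    have e1 := h0 1
    simp only [Matrix.cons_val_zero, Matrix.cons_val_one] at e0 e1
    linarith
  have hle : Module.finrank ℚ ↥(oddChowlaMilnorSpace 2 12) ≤ 1 := by
    rw [oddChowlaMilnorSpace_two_twelve]
    have h2 : Module.finrank ℚ ↥(Submodule.span ℚ (Set.range ![hurwitzOdd 2 (1 / 12), hurwitzOdd 2 (5 / 12)])) ≤ 2 := by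
      have h := finrank_range_le_card (R := ℚ) ![hurwitzOdd 2 (1 / 12), hurwitzOdd 2 (5 / 12)]
      unfold Set.finrank at h
      simpa using h
    have hne : Module.finrank ℚ ↥(Submodule.span ℚ (Set.range ![hurwitzOdd 2 (1 / 12), hurwitzOdd 2 (5 / 12)])) ≠ 2 := by
      intro h
      refine hdep (linearIndependent_iff_card_eq_finrank_span.2 ?_)
      show Fintype.card (Fin 2) = Module.finrank ℚ ↥(Submodule.span ℚ (Set.range ![hurwitzOdd 2 (1 / 12),
        hurwitzOdd 2 (5 / 12)]))
      rw [Fintype.card_fin, h]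
    omega
  -- contradiction with the conjecture at `(2, 12)` in Lai–Li's form
  have hodd := ((finrank_span_eq_totient_iff (k := 2) (q := 12) le_rfl (by norm_num)).1 hCM).1
  have hφ : Nat.totient 12 = 4 := by decide
  rw [hφ] at hodd
  omega

end Literature.NumberTheory.Irrationality.DirichletLValues

end
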